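import Mathlib
import Literature.Computability.Complexity.CNF
import Summits.PneNP.PneNP.Theorems.OverlapGapAlgebraNoStableSection
import Summits.PneNP.PneNP.Theorems.OverlapGapAlgebraSolvableImpliesStableSectionMeanSquareTransfer

/-!
# PneNP / OverlapGapAlgebra — `SearchHardWindow` (stmt-PneNP-2460): the MEAN-SQUARE (ℓ²-stable) rung

Support for crux `stmt-PneNP-2460` (`Summit.PneNP.PneNP.Theses.OverlapGapAlgebra.SearchHardWindow`).
The mean-square transfer (`sissMS_concl_of_meanSquareStableSolver`, crux `SolvableImpliesStableSection`
side) and the PROVED probability crux `NoStableSection` (`noStableSection_proof`, Bresler–Huang's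
ensemble multi-OGP read for all maps) contradict each other on any ℓ²-stable map that succeeds with
constant probability in the Bresler–Huang window. Hence, UNCONDITIONALLY:

* `shwMS_meanSquareStableMapsFail_of_noStableSection`, `shwMS_meanSquareStableMapsFail` — for all
  `k ≥ k₀`, every `s₂` with `s₂(n) log³ n = o(n)` and every `ε > 0`, eventually in `n` EVERY search map
  `g` on `F_k(n, ⌊α_k n⌋)`, `α_k = 5·2^k log k/k`, of mean-square single-literal-resample sensitivity at
  most `s₂(n)` (`∑_{(a,b)} ∑_{(Φ,ℓ)} d_H(g Φ, g Φ[(a,b) ↦ ℓ])² ≤ s₂(n)·(m k)·#Inst·2n`) solves at most an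
  `ε`-fraction of the instances;
* `shwMS_hardnessConjunct_meanSquare` — the crux's hardness conjunct (success ratio eventually `≤ ε`,
  every `ε > 0`), verbatim shape, for ANY `f : List Bool → List Bool` (no complexity hypothesis) whose
  decoded section is eventually ℓ²-stable at that scale.

This is the stable-algorithms content of Bresler–Huang 2021 Thm 2.6 in its natural mean-square
generality and boosted to EVERY constant success level (the theorem in print bounds the success
probability of stable algorithms away from `1` only); it contains the strong Lipschitz rung
(`shwLip_hardnessConjunct_lipschitz`, `s₂ = s²`) and covers maps with rare full recomputation. What
`SearchHardWindow` asserts beyond it is failure for polynomial-time maps that are NOT ℓ²-stable at scale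
`o(n / log³ n)`.
No new definitions; axioms `propext`, `Classical.choice`, `Quot.sound`.
-/

set_option linter.dupNamespace false -- `Summit.PneNP.PneNP.…`: summit = sub-problem (D-0017)

namespace Summit.PneNP.PneNP.Theorems

open Finset Filter Asymptotics
open scoped Classical

/-- **ℓ²-stable maps fail in the Bresler–Huang window, modulo `NoStableSection`.** Assuming the
route's probability crux `NoStableSection` (stmt-PneNP-2462, proved): for all `k ≥ k₀`, every
`s₂ : ℕ → ℝ` with `s₂(n) log³ n = o(n)` and every `ε > 0`, eventually in `n` every map `g` on
`F_k(n, ⌊α_k n⌋)` with `∑_{(a,b)} ∑_{(Φ,ℓ)} d_H(g Φ, g Φ[(a,b) ↦ ℓ])² ≤ s₂(n)·(m k)·#Inst·2n` solves at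
most `ε·#Inst` instances. (If not, the mean-square transfer makes `g` an `ηn`-stable `νm`-valid section
on `≥ e^{-cn/2}·#paths` path tuples infinitely often, against `NoStableSection`'s `≤ e^{-cn}·#paths`.) -/
theorem shwMS_meanSquareStableMapsFail_of_noStableSection
    (hNo : Summit.PneNP.PneNP.Theses.OverlapGapAlgebra.NoStableSection) :
    ∃ k₀ : ℕ, ∀ k : ℕ, k₀ ≤ k → ∀ s₂ : ℕ → ℝ,
      (fun n : ℕ => s₂ n * Real.log n ^ 3) =o[atTop] (fun n : ℕ => (n : ℝ)) →
      ∀ ε : ℝ, 0 < ε → ∀ᶠ n : ℕ in atTop, ∀ m : ℕ, m = ⌊5 * 2 ^ k * Real.log k / k * n⌋₊ →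
        ∀ g : (Fin m → Fin k → Fin n × Bool) → (Fin n → Bool),
          (∑ a : Fin m, ∑ b : Fin k, ∑ p : (Fin m → Fin k → Fin n × Bool) × (Fin n × Bool),
            (hammingDist (g p.1) (g (Function.update p.1 a (Function.update (p.1 a) b p.2))) : ℝ) ^ 2)
            ≤ s₂ n * (((m * k : ℕ) : ℝ) * (Fintype.card (Fin m → Fin k → Fin n × Bool) * (2 * n))) →
          ((Finset.univ.filter fun Φ : Fin m → Fin k → Fin n × Bool =>
              ∀ i, ∃ j, g Φ (Φ i j).1 = (Φ i j).2).card : ℝ)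
            ≤ ε * Fintype.card (Fin m → Fin k → Fin n × Bool) := by
  obtain ⟨k₀, hk₀⟩ := hNo
  refine ⟨max k₀ 2, fun k hk s₂ hs ε hε => ?_⟩
  have hk₀k : k₀ ≤ k := le_trans (le_max_left _ _) hk
  have hk2 : 2 ≤ k := le_trans (le_max_right _ _) hk
  have hk1 : 1 ≤ k := le_trans (by norm_num) hk2
  obtain ⟨η, hη, ν, hν, c, hc, hNSS⟩ := hk₀ k hk₀k
  have hαpos : 0 < 5 * 2 ^ k * Real.log k / k := by
    have hk2R : (2 : ℝ) ≤ k := by exact_mod_cast hk2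
    have hlogk : 0 < Real.log k := Real.log_pos (by linarith only [hk2R])
    positivity
  -- suppose not: frequently some ℓ²-stable map succeeds on more than `ε·#Inst` instances
  by_contra hcon
  rw [Filter.not_eventually] at hcon
  have hsolv : ∃ᶠ n : ℕ in atTop, ∀ m : ℕ, m = ⌊5 * 2 ^ k * Real.log k / k * n⌋₊ →
      ∃ g : (Fin m → Fin k → Fin n × Bool) → (Fin n → Bool),
        (∑ a : Fin m, ∑ b : Fin k, ∑ p : (Fin m → Fin k → Fin n × Bool) × (Fin n × Bool),
          (hammingDist (g p.1) (g (Function.update p.1 a (Function.update (p.1 a) b p.2))) : ℝ) ^ 2)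
          ≤ s₂ n * (((m * k : ℕ) : ℝ) * (Fintype.card (Fin m → Fin k → Fin n × Bool) * (2 * n))) ∧
        ε * Fintype.card (Fin m → Fin k → Fin n × Bool) ≤
          ((Finset.univ.filter fun Φ : Fin m → Fin k → Fin n × Bool =>
            ∀ i, ∃ j, g Φ (Φ i j).1 = (Φ i j).2).card : ℝ) := by
    refine hcon.mono fun n hn => ?_
    push Not at hn
    obtain ⟨m, hm, g, hgMS, hlt⟩ := hn
    intro m' hm'
    have hmm : m = m' := hm.trans hm'.symm
    subst hmm
    exact ⟨g, hgMS, hlt.le⟩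
  have hc2 : 0 < c / 2 := by positivity
  have hconcl := sissMS_concl_of_meanSquareStableSolver k hk1 (5 * 2 ^ k * Real.log k / k) η ν hαpos
    hη hν s₂ hs ε hε hsolv (c / 2) hc2
  -- contradiction with `NoStableSection`'s eventual upper bound
  obtain ⟨n, hn, hNn, hn1⟩ := (hconcl.and_eventually (hNSS.and (eventually_ge_atTop 1))).exists
  obtain ⟨g, hg⟩ := hn _ rfl
  have hup := hNn _ rfl g
  have key : Real.exp (-(c / 2 * n)) *
      (Fintype.card (Fin (k + 1) → Fin ⌊5 * 2 ^ k * Real.log k / k * n⌋₊ → Fin k → Fin n × Bool) : ℝ)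
      ≤ Real.exp (-(c * n)) *
        (Fintype.card (Fin (k + 1) → Fin ⌊5 * 2 ^ k * Real.log k / k * n⌋₊ → Fin k → Fin n × Bool) : ℝ) :=
    hg.trans (((Nat.cast_le (α := ℝ)).2 (Finset.card_le_card fun Ψ h => by simpa using h)).trans hup)
  haveI : Nonempty (Fin n × Bool) := ⟨(⟨0, hn1⟩, true)⟩
  have hP : (0 : ℝ) <
      (Fintype.card (Fin (k + 1) → Fin ⌊5 * 2 ^ k * Real.log k / k * n⌋₊ → Fin k → Fin n × Bool) : ℝ) := by
    exact_mod_cast Fintype.card_pos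
  have hexp := le_of_mul_le_mul_right key hP
  rw [Real.exp_le_exp] at hexp
  have hnR : (1 : ℝ) ≤ n := by exact_mod_cast hn1
  have hcn : 0 < c * n := by positivity
  linarith only [hexp, hcn]

/-- **ℓ²-stable maps fail in the Bresler–Huang window (unconditional).** For all `k ≥ k₀`, every
`s₂ : ℕ → ℝ` with `s₂(n) log³ n = o(n)` and every `ε > 0`, eventually in `n` every search map `g` on
`F_k(n, ⌊α_k n⌋)`, `α_k = 5·2^k log k/k`, of mean-square single-literal-resample sensitivity at most
`s₂(n)` solves at most an `ε`-fraction of the instances. (`NoStableSection` is proved: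
`noStableSection_proof`.) -/
theorem shwMS_meanSquareStableMapsFail :
    ∃ k₀ : ℕ, ∀ k : ℕ, k₀ ≤ k → ∀ s₂ : ℕ → ℝ,
      (fun n : ℕ => s₂ n * Real.log n ^ 3) =o[atTop] (fun n : ℕ => (n : ℝ)) →
      ∀ ε : ℝ, 0 < ε → ∀ᶠ n : ℕ in atTop, ∀ m : ℕ, m = ⌊5 * 2 ^ k * Real.log k / k * n⌋₊ →
        ∀ g : (Fin m → Fin k → Fin n × Bool) → (Fin n → Bool),
          (∑ a : Fin m, ∑ b : Fin k, ∑ p : (Fin m → Fin k → Fin n × Bool) × (Fin n × Bool),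
            (hammingDist (g p.1) (g (Function.update p.1 a (Function.update (p.1 a) b p.2))) : ℝ) ^ 2)
            ≤ s₂ n * (((m * k : ℕ) : ℝ) * (Fintype.card (Fin m → Fin k → Fin n × Bool) * (2 * n))) →
          ((Finset.univ.filter fun Φ : Fin m → Fin k → Fin n × Bool =>
              ∀ i, ∃ j, g Φ (Φ i j).1 = (Φ i j).2).card : ℝ)
            ≤ ε * Fintype.card (Fin m → Fin k → Fin n × Bool) :=
  shwMS_meanSquareStableMapsFail_of_noStableSection noStableSection_proof

/-- **The crux's hardness conjunct for ℓ²-stable solvers (verbatim shape, unconditional).** For all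
`k ≥ k₀` and ANY `f : List Bool → List Bool` (no complexity hypothesis) whose decoded section
`Φ ↦ (v ↦ (f ⌜Φ⌝).getD v false)` on `F_k(n, ⌊α_k n⌋)` has, eventually in `n`, mean-square
single-literal-resample sensitivity at most `s₂(n)` with `s₂(n) log³ n = o(n)`: the success ratio of
`f` is eventually `≤ ε` for every `ε > 0` — the inner conjunct of `SearchHardWindow` at `(k, α_k)`. -/
theorem shwMS_hardnessConjunct_meanSquare :
    ∃ k₀ : ℕ, ∀ k : ℕ, k₀ ≤ k → ∀ (f : List Bool → List Bool) (s₂ : ℕ → ℝ),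
      (fun n : ℕ => s₂ n * Real.log n ^ 3) =o[atTop] (fun n : ℕ => (n : ℝ)) →
      (∀ᶠ n : ℕ in atTop, ∀ m : ℕ, m = ⌊5 * 2 ^ k * Real.log k / k * n⌋₊ →
        ∃ g : (Fin m → Fin k → Fin n × Bool) → (Fin n → Bool),
          (∀ (Φ : Fin m → Fin k → Fin n × Bool) (v : Fin n), g Φ v =
            (f (Literature.Computability.Complexity.encodingCNF.encode (List.ofFn fun a =>
              List.ofFn fun b => (((Φ a b).1 : ℕ), (Φ a b).2)))).getD v false) ∧
          (∑ a : Fin m, ∑ b : Fin k, ∑ p : (Fin m → Fin k → Fin n × Bool) × (Fin n × Bool),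
            (hammingDist (g p.1) (g (Function.update p.1 a (Function.update (p.1 a) b p.2))) : ℝ) ^ 2)
            ≤ s₂ n * (((m * k : ℕ) : ℝ) * (Fintype.card (Fin m → Fin k → Fin n × Bool) * (2 * n)))) →
      ∀ ε : ℝ, 0 < ε → ∀ᶠ n : ℕ in Filter.atTop, ∀ m : ℕ, m = ⌊5 * 2 ^ k * Real.log k / k * n⌋₊ →
        ((Finset.univ.filter fun Φ : Fin m → Fin k → Fin n × Bool => ∀ i, ∃ j,
            (f (Literature.Computability.Complexity.encodingCNF.encode (List.ofFn fun a =>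
              List.ofFn fun b => (((Φ a b).1 : ℕ), (Φ a b).2)))).getD (Φ i j).1 false =
                (Φ i j).2).card : ℝ) / Fintype.card (Fin m → Fin k → Fin n × Bool) ≤ ε := by
  obtain ⟨k₀, h⟩ := shwMS_meanSquareStableMapsFail
  refine ⟨k₀, fun k hk f s₂ hs hf ε hε => ?_⟩
  filter_upwards [h k hk s₂ hs ε hε, hf] with n hmain hfn m hm
  obtain ⟨g, hgf, hg⟩ := hfn m hm
  have hle := hmain m hm g hg
  have hset : ((Finset.univ.filter fun Φ : Fin m → Fin k → Fin n × Bool => ∀ i, ∃ j,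
      (f (Literature.Computability.Complexity.encodingCNF.encode (List.ofFn fun a =>
        List.ofFn fun b => (((Φ a b).1 : ℕ), (Φ a b).2)))).getD (Φ i j).1 false = (Φ i j).2))
      = (Finset.univ.filter fun Φ : Fin m → Fin k → Fin n × Bool =>
          ∀ i, ∃ j, g Φ (Φ i j).1 = (Φ i j).2) := by
    refine Finset.filter_congr fun Φ _ => ?_
    simp only [hgf]
  rw [hset]
  by_cases hN : (Fintype.card (Fin m → Fin k → Fin n × Bool) : ℝ) = 0
  · rw [hN, div_zero]; exact hε.le
  · have hNpos : (0 : ℝ) < Fintype.card (Fin m → Fin k → Fin n × Bool) :=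
      lt_of_le_of_ne (Nat.cast_nonneg _) (Ne.symm hN)
    rw [div_le_iff₀ hNpos]
    exact hle

end Summit.PneNP.PneNP.Theorems
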